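import Summits.QuantumFields.BalabanUV.Beta.FP.TorusCompositeInsertionKernelTwoSym
import Summits.QuantumFields.BalabanUV.Beta.FP.TorusCompositeInsertionKernelSingle

/-!
# `BalabanUV.Beta.FP.TorusCompositeInsertionKernelSingleSym` — road «FP» for binder row D1, ROUTE T, (β1) «sym» column: **THE KERNEL-LEVEL (S3-2) SYM JUNCTION AT ONE
# LATTICE-LABELLED BOND (order 1) AND BOND PAIR (order 2) — the literal entries of the `-Sym` door's sockets `hQF₁′ ∕ hQN₁′` and `hQF₂ ∕ hQN₂` at `Q₁₁f := compIns₁Sym`,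
# `Q₁₂f := compIns₂₂Sym`, WITH THE ORDER-2 WRAP-AROUND LETTER LOCATED** (the (β1) twin of `TorusCompositeInsertionKernelSingle`, proofs line for line)

WHY.  `TorusCompositeInsertionKernelSym` (order 1) and `TorusCompositeInsertionKernelTwoSym` (order 2) identify, at the centred tower and for every root list, for ALL torus weights, the `h`- (resp.
`h ⊗ h′`-) weighted sums over the copies of a windowed lattice family whose border entries are a kernel of the functional with the entries of `compIns₁Sym … h` ∕
`compIns₂₂Sym … h h′`.  The (S3-2) sockets of the sym door (#41d-Sym `TowerLawFullIndexSym`, #42a-Sym `TowerKernelLawSym`) bind ONE lattice-labelled bond ∕ bond pair: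
`Q₁₁f (dv a₂) = (perF T (dper T (𝒱 ν z))).submatrix fF ff`, `½ • (Q₁₂f (dv a₁) (dv a₂) + Q₁₂f (dv a₂) (dv a₁)) = (perF T (dper T (𝒲 μ 0 ν z))).submatrix fF ff`.
* §1 ORDER 1, EVERY BOX: `perZ T (dper T (𝒱 κ′ u)) (Lc^n • x̄) z (inr κ) (inl β) = compIns₁Sym Lc M lev rs n δ_{(wrapPt T u, κ′)} (x̄, κ) (z, β)` for every LATTICE bond
  `(κ′, u)` — the order-1 file at the indicator weight; `dper` sees the bond only through the torus bond (g16 `dper_translate_bond`).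
* §3 ORDER 2 AT ONE BOND PAIR, UNDER THE SEPARATION LETTER `hsep` («the window of the multiplier site holds no copy of `u` together with a copy of `u′` of a
  DIFFERENT period vector»): `perZ T (dper T (𝒲 κ u κ′ u′)) (Lc^n • x̄) z (inr κ₀) (inl β) = compIns₂₂Sym Lc M lev rs n δ_{(wrapPt T u, κ)} δ_{(wrapPt T u′, κ′)} (x̄, κ₀) (z, β)`
  and the symmetrised form `½ • (… + …)` (`compIns₂₂Sym_comm`).  WHY A LETTER: by the order-2 file ALL pairs of copies `(u + T∘m₁, u′ + T∘m₂)` load the torus bi-jet, whereas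
  `dper T (𝒲 κ u κ′ u′)` of a jointly block-covariant family is the sum over the SIMULTANEOUS copies `m₁ = m₂` (g16 §7 `dper_apply_of_blockCov₂` and its LOCATED
  REMARK); the two agree iff no window pairs copies of different period vectors; the RELATIVE period sum `Σ'_{m′} perZ T (dper T (𝒲 κ u κ′ (u′ + T∘m′)))`
  IS the bi-jet entry at EVERY box with no letter (`tsum_perZ_dper_translate_eq_compIns₂₂Sym_apply_single`).  §2 `sep_of_window_lt` (a copy of the rooted file's) DISCHARGES `hsep` from «window extent + bond separation
  < period in every direction» — true for every box of a growing sequence beyond some `K₀(u − u′, window)`, false for small boxes (the wrap-around pairs are real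
  there): the order-2 namings are to be instantiated on the TAIL of the box sequence (the per-box law's conclusion does not see which boxes were used).
No lattice object is DEFINED; `𝒱 ∕ 𝒲 ∕ 𝓡 ∕ 𝓘₁ ∕ 𝓘₂` are the row's.

[folklore] finite sums + finitely supported `tsum` re-indexing BY NAME (the two sym kernel files, g16 `dper_apply_of_blockCov₂ ∕ dper_translate_bond`, GAN24
`KernelPeriodisation.translate_wrap_quo`, Mathlib `Summable.tsum_comm ∕ tsum_eq_single ∕ Equiv.tsum_eq`); no `def`, no `def … : Prop`, nothing cited, 0 sorry;
NO chart; nothing of Bałaban's asserted.  NOT HERE: the row's families and the (C1) TABLE words; the field–field blocks; estimates.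

HONEST DEPENDENCY (page 1, mandatory): continuum YM on T⁴ ⇐ BetaPertH ∧ nine spine estimates (0/9 proved); BetaPertH ⇐ (D1) ∧ (D4) ∧ CAP+tail;
G-an2-4 gates asym, D1 and NE2/3/4.  HONEST FRAMING (cell contract, verbatim): «discharging `BetaPertH` makes Bałaban's UV stability UNCONDITIONAL —
a real constructive-QFT result; it is NOT the continuum limit and NOT the Clay problem.»  ABSOLUTE RULE (cell charter, verbatim): «No internally-minted
statement may enter as a cited fact. Every hypothesis is either kernel-proved in this package or a verbatim quotation of a PUBLISHED theorem with page
reference. The manuscript(s) under audit are NOT citable for their own disputed steps — they are the thing under adjudication; programme-internal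
(2001/route/tribunal) claims are never citable.»  0 estimates; 0∕4 row-D1 binders (hW, hR, D1Tel, D1Rep); NOT (T-ID), NOT (C1), NOT SDF, NOT D1,
NOT BetaPertH, NOT continuum, NOT Clay.  D1 formalisation swarm LEAF PROVER 02 (b2b-balaban-beta-d1-formalise-leaf-02 gen 32), 2026-08-24.  No existing file touched.
v1.1 (leaf-02 g33, 2026-08-25): the window-separation letter `sep_of_window_lt` is READ BY NAME from the rooted R-11 `TorusCompositeInsertionKernelSingle` instead of re-typed (`dedup.landed` is α-invariant); the other declarations byte-identical to v1 48194f6e1144906e.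
-/

noncomputable section

open scoped BigOperators

namespace Summit.QuantumFields.BalabanUV.Beta.FP.TorusCompositeInsertionKernelSingleSym

open Matrix Finset
open Literature.MathematicalPhysics.QuantumFieldTheory
open Literature.MathematicalPhysics.QuantumFieldTheory.Balaban1983to89
open Literature.MathematicalPhysics.QuantumFieldTheory.Balaban1983to89.Beta
open B5Prop11Plancherel (fine)
open B6Lemma24Torus (pbox mem_pbox wrap)
open B4TorusKernel.MultiPeriod (translate translate_apply)
open B4Reflection242 (translate_translate)
open ExpKernelCalculus (MKer shiftK)
open AffineAveraging (Site Form1 box toSite)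
open AveragingContoursRooted (ctr ctrOff)
open Summit.QuantumFields.BalabanUV.Beta.SymAveragingHessianCounts (symVhKerAt symLinKerAt)
open Summit.QuantumFields.BalabanUV.Beta.SymAveragingMixedJetTables (symVh2KerAt)
open OneStepResolventKernel (Fib)
open Summit.QuantumFields.BalabanUV.Beta.BorderedHessian (stepScale)
open Summit.QuantumFields.BalabanUV.Beta.GAN24.KernelPeriodisation (wrap_translate quo translate_wrap_quo)
open Summit.QuantumFields.BalabanUV.Beta.FP.KernelPeriodisationFib (perZ perZ_apply)
open Summit.QuantumFields.BalabanUV.Beta.FP.KernelPeriodisationFibLoc (dper)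
open Summit.QuantumFields.BalabanUV.Beta.FP.PeriodisedBorderTables (dper_apply_of_blockCov₂ dper_translate_bond)
open Summit.QuantumFields.BalabanUV.Beta.FP.TorusGaugeCovariancePairing (wrapPt wrapPt_coe wrapPt_of_mem)
open Summit.QuantumFields.BalabanUV.Beta.FP.TorusCompositeObjects (towerTorus towerTorus_apply)
open Summit.QuantumFields.BalabanUV.Beta.FP.TorusCompositeCovarianceOneSym (compIns₁Sym)
open Summit.QuantumFields.BalabanUV.Beta.FP.TorusCompositeCovarianceTwoPolarSym (compIns₂₂Sym compIns₂₂Sym_comm)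
open Summit.QuantumFields.BalabanUV.Beta.FP.TorusStepInsertionPeriodic (exists_finset_translate)
open Summit.QuantumFields.BalabanUV.Beta.FP.TorusCompositeInsertionKernelSym (sum_mul_perZ_dper_eq_compIns₁Sym_apply)
open Summit.QuantumFields.BalabanUV.Beta.FP.TorusCompositeInsertionKernelTwoSym (sum_sum_mul_tsum₂_eq_compIns₂₂Sym_apply)
open Summit.QuantumFields.BalabanUV.Beta.FP.TorusCompositeInsertionKernelSingle (sep_of_window_lt)

variable {d : ℕ} (Lc : ℕ) [NeZero Lc]

/-! ## §1 Order 1 at ONE lattice-labelled bond (every box) -/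

/-- [folklore] **THE ORDER-1 SYM KERNEL JUNCTION AT ONE LATTICE-LABELLED BOND**: under `TorusCompositeInsertionKernelSym`'s letters, for EVERY lattice bond `(κ′, u)` (not only box representatives) and every box,
`perZ T (dper T (𝒱 κ′ u)) (Lc^n • x̄) z (inr κ) (inl β) = compIns₁Sym Lc M lev rs n δ_{(wrapPt T u, κ′)} (x̄, κ) (z, β)` — the literal entry of the (S3-2) socket
`hQF₁′ : Q₁₁f (dv a₂) = (perF T (dper T (𝒱 ν z))).submatrix fF ff` at `Q₁₁f := compIns₁Sym …`, `dv a₂ := δ_{(wrapPt T z, ν)}`. -/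
theorem perZ_dper_eq_compIns₁Sym_apply_single
    (hc : ctrOff (d + 1) Lc ∈ box (d + 1) Lc)
    (𝓡 : (ℕ → ℕ) → ℕ → Form1 (d + 1) ℝ → Form1 (d + 1) ℝ)
    (hR0 : ∀ (lev : ℕ → ℕ) (B : Form1 (d + 1) ℝ), 𝓡 lev 0 B = B)
    (hRsucc : ∀ (lev : ℕ → ℕ) (n : ℕ) (B : Form1 (d + 1) ℝ) (κ : Fin (d + 1)) (x : Site (d + 1)),
      𝓡 lev (n + 1) B κ x = stepScale d Lc (lev 1) * ((Lc : ℝ) ^ (d + 1)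
        * ∑' z : Site (d + 1), ∑ l : Fin (d + 1), symLinKerAt (ctr (d + 1) Lc) Lc κ x (l, z) * 𝓡 (fun k => lev (k + 1)) n B l z))
    (𝓘 : (ℕ → ℕ) → ℕ → Form1 (d + 1) ℝ → Form1 (d + 1) ℝ → Form1 (d + 1) ℝ)
    (h0 : ∀ (lev : ℕ → ℕ) (H B : Form1 (d + 1) ℝ), 𝓘 lev 0 H B = 0)
    (hsucc : ∀ (lev : ℕ → ℕ) (n : ℕ) (H B : Form1 (d + 1) ℝ) (κ : Fin (d + 1)) (x : Site (d + 1)),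
      𝓘 lev (n + 1) H B κ x
        = (((Lc : ℝ) ^ (d + 1) * stepScale d Lc (lev 1)) * (∏ i ∈ Finset.range n, (stepScale d Lc (lev (i + 1 + 1)) * ((box (d + 1) Lc).card : ℝ)))⁻¹) *
            (∑' u : Site (d + 1), ∑ κ' : Fin (d + 1),
              (∑' z : Site (d + 1), ∑ l : Fin (d + 1), symVhKerAt (ctr (d + 1) Lc) Lc κ x (l, z) (κ', u) * 𝓡 (fun k => lev (k + 1)) n B l z) *
                𝓡 (fun k => lev (k + 1)) n H κ' u)
          + stepScale d Lc (lev 1) * ((Lc : ℝ) ^ (d + 1) *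
              ∑' z : Site (d + 1), ∑ l : Fin (d + 1), symLinKerAt (ctr (d + 1) Lc) Lc κ x (l, z) * 𝓘 (fun k => lev (k + 1)) n H B l z))
    (n : ℕ) (M : Fin (d + 1) → ℕ) [∀ μ, NeZero (M μ)] (lev : ℕ → ℕ) (rs : ℕ → (Fin (d + 1) → ℕ))
    (𝒱 : Fin (d + 1) → Site (d + 1) → MKer (d + 1) (Fib d)) (W : Site (d + 1) → Finset (Site (d + 1)))
    (hVt : ∀ (κ' : Fin (d + 1)) (u t : Site (d + 1)), 𝒱 κ' (u + (((Lc ^ n : ℕ) : ℤ)) • t) = shiftK (-((((Lc ^ n : ℕ) : ℤ)) • t)) (𝒱 κ' u))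
    (hS : ∀ (κ' : Fin (d + 1)) (u x : Site (d + 1)) (μ α : Fin (d + 1)), ∀ z ∉ W x, 𝒱 κ' u x z (Sum.inr μ) (Sum.inl α) = 0)
    (hT : ∀ (κ' : Fin (d + 1)) (x z : Site (d + 1)) (μ α : Fin (d + 1)), ∀ u ∉ W x, 𝒱 κ' u x z (Sum.inr μ) (Sum.inl α) = 0)
    (h𝒱 : ∀ (H B : Form1 (d + 1) ℝ) (κ : Fin (d + 1)) (x : Site (d + 1)),
      (∑' u : Site (d + 1), ∑ κ' : Fin (d + 1),
        (∑' z : Site (d + 1), ∑ l : Fin (d + 1), 𝒱 κ' u ((((Lc ^ n : ℕ) : ℤ)) • x) z (Sum.inr κ) (Sum.inl l) * B l z) * H κ' u) = 𝓘 lev n H B κ x)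
    (κ' : Fin (d + 1)) (u : Site (d + 1)) (x : ↥(pbox M)) (κ : Fin (d + 1)) (z : ↥(pbox (towerTorus Lc M n))) (β : Fin (d + 1)) :
    perZ (towerTorus Lc M n) (dper (towerTorus Lc M n) (𝒱 κ' u)) ((((Lc ^ n : ℕ) : ℤ)) • (x : Site (d + 1))) (z : Site (d + 1)) (Sum.inr κ) (Sum.inl β)
      = compIns₁Sym Lc M lev rs n (fun b => if b = (wrapPt (towerTorus Lc M n) u, κ') then 1 else 0) (x, κ) (z, β) := by
  classical
  have hM : ∀ i, towerTorus Lc M n i = Lc ^ n * M i := fun i => towerTorus_apply Lc M n i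
  rw [← sum_mul_perZ_dper_eq_compIns₁Sym_apply Lc hc 𝓡 hR0 hRsucc 𝓘 h0 hsucc n M lev rs 𝒱 W hVt hS hT h𝒱 _ x κ z β]
  simp only [ite_mul, one_mul, zero_mul, Finset.sum_ite_eq', Finset.mem_univ, if_true]
  -- `dper` depends on the bond only through the torus bond: `u = wrap T u + T∘quo T u`
  have hu : dper (towerTorus Lc M n) (𝒱 κ' u) = dper (towerTorus Lc M n) (𝒱 κ' (wrapPt (towerTorus Lc M n) u : Site (d + 1))) := by
    rw [wrapPt_coe, ← dper_translate_bond hM hVt κ' (wrap (towerTorus Lc M n) u) (quo (towerTorus Lc M n) u), translate_wrap_quo]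
  rw [hu]

/-! ## §2 The separation letter from «window extent + bond separation < period» -/

/-! ## §3 Order 2 at ONE lattice-labelled bond pair: under the separation letter, and as the relative period sum -/

section OrderTwo

variable
    (hc : ctrOff (d + 1) Lc ∈ box (d + 1) Lc)
    (𝓡 : (ℕ → ℕ) → ℕ → Form1 (d + 1) ℝ → Form1 (d + 1) ℝ)
    (hR0 : ∀ (lev : ℕ → ℕ) (B : Form1 (d + 1) ℝ), 𝓡 lev 0 B = B)
    (hRsucc : ∀ (lev : ℕ → ℕ) (n : ℕ) (B : Form1 (d + 1) ℝ) (κ : Fin (d + 1)) (x : Site (d + 1)),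
      𝓡 lev (n + 1) B κ x = stepScale d Lc (lev 1) * ((Lc : ℝ) ^ (d + 1)
        * ∑' z : Site (d + 1), ∑ l : Fin (d + 1), symLinKerAt (ctr (d + 1) Lc) Lc κ x (l, z) * 𝓡 (fun k => lev (k + 1)) n B l z))
    (𝓘₁ : (ℕ → ℕ) → ℕ → Form1 (d + 1) ℝ → Form1 (d + 1) ℝ → Form1 (d + 1) ℝ)
    (h0₁ : ∀ (lev : ℕ → ℕ) (H B : Form1 (d + 1) ℝ), 𝓘₁ lev 0 H B = 0)
    (hsucc₁ : ∀ (lev : ℕ → ℕ) (n : ℕ) (H B : Form1 (d + 1) ℝ) (κ : Fin (d + 1)) (x : Site (d + 1)),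
      𝓘₁ lev (n + 1) H B κ x
        = (((Lc : ℝ) ^ (d + 1) * stepScale d Lc (lev 1)) * (∏ i ∈ Finset.range n, (stepScale d Lc (lev (i + 1 + 1)) * ((box (d + 1) Lc).card : ℝ)))⁻¹) *
            (∑' u : Site (d + 1), ∑ κ' : Fin (d + 1),
              (∑' z : Site (d + 1), ∑ l : Fin (d + 1), symVhKerAt (ctr (d + 1) Lc) Lc κ x (l, z) (κ', u) * 𝓡 (fun k => lev (k + 1)) n B l z) *
                𝓡 (fun k => lev (k + 1)) n H κ' u)
          + stepScale d Lc (lev 1) * ((Lc : ℝ) ^ (d + 1) *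
              ∑' z : Site (d + 1), ∑ l : Fin (d + 1), symLinKerAt (ctr (d + 1) Lc) Lc κ x (l, z) * 𝓘₁ (fun k => lev (k + 1)) n H B l z))
    (𝓘₂ : (ℕ → ℕ) → ℕ → Form1 (d + 1) ℝ → Form1 (d + 1) ℝ → Form1 (d + 1) ℝ → Form1 (d + 1) ℝ)
    (h0₂ : ∀ (lev : ℕ → ℕ) (H H' B : Form1 (d + 1) ℝ), 𝓘₂ lev 0 H H' B = 0)
    (hsucc₂ : ∀ (lev : ℕ → ℕ) (n : ℕ) (H H' B : Form1 (d + 1) ℝ) (κ₀ : Fin (d + 1)) (x : Site (d + 1)),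
      𝓘₂ lev (n + 1) H H' B κ₀ x
        = ((((Lc : ℝ) ^ (d + 1) * stepScale d Lc (lev 1)) * (∏ i ∈ Finset.range n, (stepScale d Lc (lev (i + 1 + 1)) * ((box (d + 1) Lc).card : ℝ)))⁻¹)
            * (∏ i ∈ Finset.range n, (stepScale d Lc (lev (i + 1 + 1)) * ((box (d + 1) Lc).card : ℝ)))⁻¹) *
            (∑' u : Site (d + 1), ∑ κ : Fin (d + 1), (∑' u' : Site (d + 1), ∑ κ' : Fin (d + 1),
              (∑' z : Site (d + 1), ∑ l : Fin (d + 1),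
                (1 / 2 : ℝ) * (symVh2KerAt (ctr (d + 1) Lc) Lc κ₀ x (l, z) (κ, u) (κ', u') + symVh2KerAt (ctr (d + 1) Lc) Lc κ₀ x (l, z) (κ', u') (κ, u)) *
                  𝓡 (fun k => lev (k + 1)) n B l z) *
              𝓡 (fun k => lev (k + 1)) n H' κ' u') * 𝓡 (fun k => lev (k + 1)) n H κ u)
          + (((Lc : ℝ) ^ (d + 1) * stepScale d Lc (lev 1)) * (∏ i ∈ Finset.range n, (stepScale d Lc (lev (i + 1 + 1)) * ((box (d + 1) Lc).card : ℝ)))⁻¹) *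
            ((∑' u : Site (d + 1), ∑ κ' : Fin (d + 1),
              (∑' z : Site (d + 1), ∑ l : Fin (d + 1), symVhKerAt (ctr (d + 1) Lc) Lc κ₀ x (l, z) (κ', u) * 𝓘₁ (fun k => lev (k + 1)) n H' B l z) *
                𝓡 (fun k => lev (k + 1)) n H κ' u)
            + (∑' u : Site (d + 1), ∑ κ' : Fin (d + 1),
              (∑' z : Site (d + 1), ∑ l : Fin (d + 1), symVhKerAt (ctr (d + 1) Lc) Lc κ₀ x (l, z) (κ', u) * 𝓘₁ (fun k => lev (k + 1)) n H B l z) *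
                𝓡 (fun k => lev (k + 1)) n H' κ' u))
          + stepScale d Lc (lev 1) * ((Lc : ℝ) ^ (d + 1) *
              ∑' z : Site (d + 1), ∑ l : Fin (d + 1), symLinKerAt (ctr (d + 1) Lc) Lc κ₀ x (l, z) * 𝓘₂ (fun k => lev (k + 1)) n H H' B l z))
    (n : ℕ) (M : Fin (d + 1) → ℕ) [∀ μ, NeZero (M μ)] (lev : ℕ → ℕ) (rs : ℕ → (Fin (d + 1) → ℕ))
    (𝒲 : Fin (d + 1) → Site (d + 1) → Fin (d + 1) → Site (d + 1) → MKer (d + 1) (Fib d)) (W : Site (d + 1) → Finset (Site (d + 1)))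
    (hWt : ∀ (κ : Fin (d + 1)) (u : Site (d + 1)) (κ' : Fin (d + 1)) (u' t : Site (d + 1)),
      𝒲 κ (u + (((Lc ^ n : ℕ) : ℤ)) • t) κ' (u' + (((Lc ^ n : ℕ) : ℤ)) • t) = shiftK (-((((Lc ^ n : ℕ) : ℤ)) • t)) (𝒲 κ u κ' u'))
    (hS : ∀ (κ : Fin (d + 1)) (u : Site (d + 1)) (κ' : Fin (d + 1)) (u' x : Site (d + 1)) (μ α : Fin (d + 1)), ∀ z ∉ W x,
      𝒲 κ u κ' u' x z (Sum.inr μ) (Sum.inl α) = 0)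
    (hT : ∀ (κ κ' : Fin (d + 1)) (u' x z : Site (d + 1)) (μ α : Fin (d + 1)), ∀ u ∉ W x, 𝒲 κ u κ' u' x z (Sum.inr μ) (Sum.inl α) = 0)
    (hT' : ∀ (κ : Fin (d + 1)) (u : Site (d + 1)) (κ' : Fin (d + 1)) (x z : Site (d + 1)) (μ α : Fin (d + 1)), ∀ u' ∉ W x,
      𝒲 κ u κ' u' x z (Sum.inr μ) (Sum.inl α) = 0)
    (h𝒲 : ∀ (H H' B : Form1 (d + 1) ℝ) (κ₀ : Fin (d + 1)) (x : Site (d + 1)),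
      (∑' u : Site (d + 1), ∑ κ : Fin (d + 1), (∑' u' : Site (d + 1), ∑ κ' : Fin (d + 1),
        (∑' z : Site (d + 1), ∑ l : Fin (d + 1), 𝒲 κ u κ' u' ((((Lc ^ n : ℕ) : ℤ)) • x) z (Sum.inr κ₀) (Sum.inl l) * B l z) * H' κ' u') * H κ u)
        = 𝓘₂ lev n H H' B κ₀ x)

include hc hR0 hRsucc h0₁ hsucc₁ h0₂ hsucc₂ hWt hS hT hT' h𝒲


/-- [folklore] **`perZ_dper_eq_compIns₂₂_apply_single` — THE (S3-2) SOCKET `hQF₂` AT `Q₁₂f := compIns₂₂Sym`, UNDER THE SEPARATION LETTER.**  Letters: `TorusCompositeInsertionKernelTwoSym`'s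
(`hR0 hRsucc h0₁ hsucc₁ h0₂ hsucc₂`, windows `hS hT hT′`, the kernel clause `h𝒲`) + joint block covariance `hWt` of `𝒲` at the blocking `Lc^n` + `hsep`: a copy `u + T∘m₁` of the
first bond and a copy `u′ + T∘m₂` of the second are both in the window of the multiplier site `Lc^n • x̄` only if `m₁ = m₂`.  Conclusion:
`perZ T (dper T (𝒲 κ u κ′ u′)) (Lc^n • x̄) z (inr κ₀) (inl β) = compIns₂₂Sym Lc M lev rs n δ_{(wrapPt T u, κ)} δ_{(wrapPt T u′, κ′)} (x̄, κ₀) (z, β)`. -/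
theorem perZ_dper_eq_compIns₂₂Sym_apply_single
    (κ : Fin (d + 1)) (u : Site (d + 1)) (κ' : Fin (d + 1)) (u' : Site (d + 1))
    (x : ↥(pbox M)) (κ₀ : Fin (d + 1)) (z : ↥(pbox (towerTorus Lc M n))) (β : Fin (d + 1))
    (hsep : ∀ m₁ m₂ : Site (d + 1), translate (towerTorus Lc M n) u m₁ ∈ W ((((Lc ^ n : ℕ) : ℤ)) • (x : Site (d + 1))) →
      translate (towerTorus Lc M n) u' m₂ ∈ W ((((Lc ^ n : ℕ) : ℤ)) • (x : Site (d + 1))) → m₁ = m₂) :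
    perZ (towerTorus Lc M n) (dper (towerTorus Lc M n) (𝒲 κ u κ' u')) ((((Lc ^ n : ℕ) : ℤ)) • (x : Site (d + 1))) (z : Site (d + 1)) (Sum.inr κ₀) (Sum.inl β)
      = compIns₂₂Sym Lc M lev rs n (fun b => if b = (wrapPt (towerTorus Lc M n) u, κ) then 1 else 0)
          (fun b => if b = (wrapPt (towerTorus Lc M n) u', κ') then 1 else 0) (x, κ₀) (z, β) := by
  classical
  have hM : ∀ i, towerTorus Lc M n i = Lc ^ n * M i := fun i => towerTorus_apply Lc M n i
  rw [← sum_sum_mul_tsum₂_eq_compIns₂₂Sym_apply Lc hc 𝓡 hR0 hRsucc 𝓘₁ h0₁ hsucc₁ 𝓘₂ h0₂ hsucc₂ n M lev rs 𝒲 W hS hT hT' h𝒲 _ _ x κ₀ z β]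
  simp only [← Finset.mul_sum]
  simp only [ite_mul, one_mul, zero_mul, Finset.sum_ite_eq', Finset.mem_univ, if_true]
  set X : Site (d + 1) := (((Lc ^ n : ℕ) : ℤ)) • (x : Site (d + 1)) with hX
  -- re-centring a copy sum at the lattice label: `v = wrap T v + T∘quo T v`
  have hre : ∀ (f : Site (d + 1) → ℝ) (v : Site (d + 1)),
      (∑' m : Site (d + 1), f (translate (towerTorus Lc M n) (wrapPt (towerTorus Lc M n) v : Site (d + 1)) m))
        = ∑' m : Site (d + 1), f (translate (towerTorus Lc M n) v m) := fun f v => by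
    rw [wrapPt_coe, ← (Equiv.addLeft (quo (towerTorus Lc M n) v)).tsum_eq]
    refine tsum_congr fun m => ?_
    rw [Equiv.coe_addLeft, ← translate_translate, translate_wrap_quo]
  -- only the simultaneous copies `m₂ = m₁` load (the separation letter)
  have hdiag : ∀ m₁ : Site (d + 1), (∑' m₂ : Site (d + 1), ∑' m : Site (d + 1), 𝒲 κ (translate (towerTorus Lc M n) u m₁) κ' (translate (towerTorus Lc M n) u' m₂) X
      (translate (towerTorus Lc M n) (z : Site (d + 1)) m) (Sum.inr κ₀) (Sum.inl β))
        = ∑' m : Site (d + 1), 𝒲 κ (translate (towerTorus Lc M n) u m₁) κ' (translate (towerTorus Lc M n) u' m₁) X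
            (translate (towerTorus Lc M n) (z : Site (d + 1)) m) (Sum.inr κ₀) (Sum.inl β) := fun m₁ => by
    refine tsum_eq_single m₁ fun m₂ hne => ?_
    refine (tsum_congr fun m => ?_).trans tsum_zero
    by_cases h₁ : translate (towerTorus Lc M n) u m₁ ∈ W X
    · by_cases h₂ : translate (towerTorus Lc M n) u' m₂ ∈ W X
      · exact (hne (hsep m₁ m₂ h₁ h₂).symm).elim
      · exact hT' κ _ κ' X _ κ₀ β _ h₂
    · exact hT κ κ' _ X _ κ₀ β _ h₁
  -- the two remaining copy sums are finitely supported: swap them, fold `dper` (simultaneous copies) and `perZ`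
  obtain ⟨F₁, hF₁⟩ := exists_finset_translate (towerTorus Lc M n) (W X) u
  obtain ⟨Fm, hFm⟩ := exists_finset_translate (towerTorus Lc M n) (W X) (z : Site (d + 1))
  have hsumm : Summable (Function.uncurry fun (m₁ m : Site (d + 1)) => 𝒲 κ (translate (towerTorus Lc M n) u m₁) κ' (translate (towerTorus Lc M n) u' m₁) X
      (translate (towerTorus Lc M n) (z : Site (d + 1)) m) (Sum.inr κ₀) (Sum.inl β)) := by
    refine summable_of_ne_finset_zero (s := F₁ ×ˢ Fm) fun p hp => ?_
    rw [Finset.mem_product, not_and_or] at hp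
    rcases hp with hp | hp
    · exact hT κ κ' _ X _ κ₀ β _ (hF₁ p.1 hp)
    · exact hS κ _ κ' _ X κ₀ β _ (hFm p.2 hp)
  symm
  calc (∑' m₁ : Site (d + 1), ∑' m₂ : Site (d + 1), ∑' m : Site (d + 1),
          𝒲 κ (translate (towerTorus Lc M n) (wrapPt (towerTorus Lc M n) u : Site (d + 1)) m₁) κ'
            (translate (towerTorus Lc M n) (wrapPt (towerTorus Lc M n) u' : Site (d + 1)) m₂) X
            (translate (towerTorus Lc M n) (z : Site (d + 1)) m) (Sum.inr κ₀) (Sum.inl β))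
      = ∑' m₁ : Site (d + 1), ∑' m₂ : Site (d + 1), ∑' m : Site (d + 1),
          𝒲 κ (translate (towerTorus Lc M n) u m₁) κ' (translate (towerTorus Lc M n) (wrapPt (towerTorus Lc M n) u' : Site (d + 1)) m₂) X
            (translate (towerTorus Lc M n) (z : Site (d + 1)) m) (Sum.inr κ₀) (Sum.inl β) :=
        hre (fun v => ∑' m₂ : Site (d + 1), ∑' m : Site (d + 1), 𝒲 κ v κ' (translate (towerTorus Lc M n) (wrapPt (towerTorus Lc M n) u' : Site (d + 1)) m₂) X
          (translate (towerTorus Lc M n) (z : Site (d + 1)) m) (Sum.inr κ₀) (Sum.inl β)) u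
    _ = ∑' m₁ : Site (d + 1), ∑' m₂ : Site (d + 1), ∑' m : Site (d + 1),
          𝒲 κ (translate (towerTorus Lc M n) u m₁) κ' (translate (towerTorus Lc M n) u' m₂) X
            (translate (towerTorus Lc M n) (z : Site (d + 1)) m) (Sum.inr κ₀) (Sum.inl β) :=
        tsum_congr fun m₁ => hre (fun v' => ∑' m : Site (d + 1), 𝒲 κ (translate (towerTorus Lc M n) u m₁) κ' v' X
          (translate (towerTorus Lc M n) (z : Site (d + 1)) m) (Sum.inr κ₀) (Sum.inl β)) u'
    _ = ∑' m₁ : Site (d + 1), ∑' m : Site (d + 1), 𝒲 κ (translate (towerTorus Lc M n) u m₁) κ' (translate (towerTorus Lc M n) u' m₁) X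
          (translate (towerTorus Lc M n) (z : Site (d + 1)) m) (Sum.inr κ₀) (Sum.inl β) := tsum_congr hdiag
    _ = ∑' m : Site (d + 1), ∑' m₁ : Site (d + 1), 𝒲 κ (translate (towerTorus Lc M n) u m₁) κ' (translate (towerTorus Lc M n) u' m₁) X
          (translate (towerTorus Lc M n) (z : Site (d + 1)) m) (Sum.inr κ₀) (Sum.inl β) := hsumm.tsum_comm.symm
    _ = ∑' m : Site (d + 1), dper (towerTorus Lc M n) (𝒲 κ u κ' u') X (translate (towerTorus Lc M n) (z : Site (d + 1)) m) (Sum.inr κ₀) (Sum.inl β) :=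
        tsum_congr fun m => (dper_apply_of_blockCov₂ hM hWt κ u κ' u' X _ (Sum.inr κ₀) (Sum.inl β)).symm
    _ = perZ (towerTorus Lc M n) (dper (towerTorus Lc M n) (𝒲 κ u κ' u')) X (z : Site (d + 1)) (Sum.inr κ₀) (Sum.inl β) := by rw [perZ_apply]

/-- [folklore] **the symmetrised socket form** (#41d ∕ #42a's `hQF₂` LHS literally, at `Q₁₂f := compIns₂₂Sym …`): under the same letters,
`½ · (compIns₂₂Sym … δ_u δ_{u′} + compIns₂₂Sym … δ_{u′} δ_u) (x̄, κ₀) (z, β) = perZ T (dper T (𝒲 κ u κ′ u′)) (Lc^n • x̄) z (inr κ₀) (inl β)` (`compIns₂₂Sym_comm`). -/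
theorem half_compIns₂₂Sym_add_comm_apply_single_eq_perZ_dper
    (κ : Fin (d + 1)) (u : Site (d + 1)) (κ' : Fin (d + 1)) (u' : Site (d + 1))
    (x : ↥(pbox M)) (κ₀ : Fin (d + 1)) (z : ↥(pbox (towerTorus Lc M n))) (β : Fin (d + 1))
    (hsep : ∀ m₁ m₂ : Site (d + 1), translate (towerTorus Lc M n) u m₁ ∈ W ((((Lc ^ n : ℕ) : ℤ)) • (x : Site (d + 1))) →
      translate (towerTorus Lc M n) u' m₂ ∈ W ((((Lc ^ n : ℕ) : ℤ)) • (x : Site (d + 1))) → m₁ = m₂) :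
    (1 / 2 : ℝ) * (compIns₂₂Sym Lc M lev rs n (fun b => if b = (wrapPt (towerTorus Lc M n) u, κ) then 1 else 0)
          (fun b => if b = (wrapPt (towerTorus Lc M n) u', κ') then 1 else 0) (x, κ₀) (z, β)
        + compIns₂₂Sym Lc M lev rs n (fun b => if b = (wrapPt (towerTorus Lc M n) u', κ') then 1 else 0)
          (fun b => if b = (wrapPt (towerTorus Lc M n) u, κ) then 1 else 0) (x, κ₀) (z, β))
      = perZ (towerTorus Lc M n) (dper (towerTorus Lc M n) (𝒲 κ u κ' u')) ((((Lc ^ n : ℕ) : ℤ)) • (x : Site (d + 1))) (z : Site (d + 1))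
          (Sum.inr κ₀) (Sum.inl β) := by
  rw [compIns₂₂Sym_comm Lc hc n M lev rs (fun b => if b = (wrapPt (towerTorus Lc M n) u', κ') then 1 else 0),
    perZ_dper_eq_compIns₂₂Sym_apply_single Lc hc 𝓡 hR0 hRsucc 𝓘₁ h0₁ hsucc₁ 𝓘₂ h0₂ hsucc₂ n M lev rs 𝒲 W hWt hS hT hT' h𝒲 κ u κ' u' x κ₀ z β hsep]
  ring

/-- [folklore] **`tsum_perZ_dper_translate_eq_compIns₂₂_apply_single` — EVERY BOX, NO SEPARATION LETTER: THE TORUS BI-JET ENTRY IS THE RELATIVE PERIOD SUM**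
(g16 `PeriodisedBorderTables` §7's LOCATED REMARK made an identity): under R-10's letters + `hWt`,
`Σ'_{m′} perZ T (dper T (𝒲 κ u κ′ (u′ + T∘m′))) (Lc^n • x̄) z (inr κ₀) (inl β) = compIns₂₂Sym Lc M lev rs n δ_{(wrapPt T u, κ)} δ_{(wrapPt T u′, κ′)} (x̄, κ₀) (z, β)` —
the second bond's copies are summed RELATIVE to the first's; the `m′ = 0` summand is the socket's `perZ T (dper T (𝒲 κ u κ′ u′))`, the `m′ ≠ 0` summands are the
wrap-around pairs, which the separation letter of `perZ_dper_eq_compIns₂₂_apply_single` kills. -/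
theorem tsum_perZ_dper_translate_eq_compIns₂₂Sym_apply_single
    (κ : Fin (d + 1)) (u : Site (d + 1)) (κ' : Fin (d + 1)) (u' : Site (d + 1))
    (x : ↥(pbox M)) (κ₀ : Fin (d + 1)) (z : ↥(pbox (towerTorus Lc M n))) (β : Fin (d + 1)) :
    (∑' m' : Site (d + 1), perZ (towerTorus Lc M n) (dper (towerTorus Lc M n) (𝒲 κ u κ' (translate (towerTorus Lc M n) u' m')))
        ((((Lc ^ n : ℕ) : ℤ)) • (x : Site (d + 1))) (z : Site (d + 1)) (Sum.inr κ₀) (Sum.inl β))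
      = compIns₂₂Sym Lc M lev rs n (fun b => if b = (wrapPt (towerTorus Lc M n) u, κ) then 1 else 0)
          (fun b => if b = (wrapPt (towerTorus Lc M n) u', κ') then 1 else 0) (x, κ₀) (z, β) := by
  classical
  have hM : ∀ i, towerTorus Lc M n i = Lc ^ n * M i := fun i => towerTorus_apply Lc M n i
  rw [← sum_sum_mul_tsum₂_eq_compIns₂₂Sym_apply Lc hc 𝓡 hR0 hRsucc 𝓘₁ h0₁ hsucc₁ 𝓘₂ h0₂ hsucc₂ n M lev rs 𝒲 W hS hT hT' h𝒲 _ _ x κ₀ z β]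
  simp only [← Finset.mul_sum]
  simp only [ite_mul, one_mul, zero_mul, Finset.sum_ite_eq', Finset.mem_univ, if_true]
  set X : Site (d + 1) := (((Lc ^ n : ℕ) : ℤ)) • (x : Site (d + 1)) with hX
  have hre : ∀ (f : Site (d + 1) → ℝ) (v : Site (d + 1)),
      (∑' m : Site (d + 1), f (translate (towerTorus Lc M n) (wrapPt (towerTorus Lc M n) v : Site (d + 1)) m))
        = ∑' m : Site (d + 1), f (translate (towerTorus Lc M n) v m) := fun f v => by
    rw [wrapPt_coe, ← (Equiv.addLeft (quo (towerTorus Lc M n) v)).tsum_eq]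
    refine tsum_congr fun m => ?_
    rw [Equiv.coe_addLeft, ← translate_translate, translate_wrap_quo]
  -- finite supports of the three copy sums
  obtain ⟨F₁, hF₁⟩ := exists_finset_translate (towerTorus Lc M n) (W X) u
  obtain ⟨F₂, hF₂⟩ := exists_finset_translate (towerTorus Lc M n) (W X) u'
  obtain ⟨Fm, hFm⟩ := exists_finset_translate (towerTorus Lc M n) (W X) (z : Site (d + 1))
  -- the summand over (first-bond copy, relative copy, fluctuation copy), and its vanishing off the finite supports
  have hv₁ : ∀ (m₁ m₂ m : Site (d + 1)), m₁ ∉ F₁ → 𝒲 κ (translate (towerTorus Lc M n) u m₁) κ' (translate (towerTorus Lc M n) u' m₂) X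
      (translate (towerTorus Lc M n) (z : Site (d + 1)) m) (Sum.inr κ₀) (Sum.inl β) = 0 := fun m₁ m₂ m h₁ => hT κ κ' _ X _ κ₀ β _ (hF₁ m₁ h₁)
  have hv₂ : ∀ (m₁ m₂ m : Site (d + 1)), m₂ ∉ F₂ → 𝒲 κ (translate (towerTorus Lc M n) u m₁) κ' (translate (towerTorus Lc M n) u' m₂) X
      (translate (towerTorus Lc M n) (z : Site (d + 1)) m) (Sum.inr κ₀) (Sum.inl β) = 0 := fun m₁ m₂ m h₂ => hT' κ _ κ' X _ κ₀ β _ (hF₂ m₂ h₂)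
  have hv₃ : ∀ (m₁ m₂ m : Site (d + 1)), m ∉ Fm → 𝒲 κ (translate (towerTorus Lc M n) u m₁) κ' (translate (towerTorus Lc M n) u' m₂) X
      (translate (towerTorus Lc M n) (z : Site (d + 1)) m) (Sum.inr κ₀) (Sum.inl β) = 0 := fun m₁ m₂ m h₃ => hS κ _ κ' _ X κ₀ β _ (hFm m h₃)
  -- (i) the pair `(m′, m₁)` with `m₁ ∈ F₁`, `m′ + m₁ ∈ F₂` ranges in a finite set
  have hsumm₁ : Summable (Function.uncurry fun (m' m₁ : Site (d + 1)) => ∑' m : Site (d + 1), 𝒲 κ (translate (towerTorus Lc M n) u m₁) κ'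
      (translate (towerTorus Lc M n) u' (m' + m₁)) X (translate (towerTorus Lc M n) (z : Site (d + 1)) m) (Sum.inr κ₀) (Sum.inl β)) := by
    refine summable_of_ne_finset_zero (s := ((F₂ ×ˢ F₁).image fun p => p.1 - p.2) ×ˢ F₁) fun p hp => ?_
    show (∑' m : Site (d + 1), 𝒲 κ (translate (towerTorus Lc M n) u p.2) κ' (translate (towerTorus Lc M n) u' (p.1 + p.2)) X
      (translate (towerTorus Lc M n) (z : Site (d + 1)) m) (Sum.inr κ₀) (Sum.inl β)) = 0
    by_cases h₁ : p.2 ∈ F₁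
    · have h₂ : p.1 + p.2 ∉ F₂ := fun h₂ => hp (Finset.mem_product.2
        ⟨Finset.mem_image.2 ⟨(p.1 + p.2, p.2), Finset.mem_product.2 ⟨h₂, h₁⟩, add_sub_cancel_right p.1 p.2⟩, h₁⟩)
      exact (tsum_congr fun m => hv₂ _ _ m h₂).trans tsum_zero
    · exact (tsum_congr fun m => hv₁ _ _ m h₁).trans tsum_zero
  -- (ii) the pair `(m₁, m)` ranges in `F₁ × Fm`, for every relative copy `m′`
  have hsumm₂ : ∀ m' : Site (d + 1), Summable (Function.uncurry fun (m₁ m : Site (d + 1)) => 𝒲 κ (translate (towerTorus Lc M n) u m₁) κ'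
      (translate (towerTorus Lc M n) u' (m' + m₁)) X (translate (towerTorus Lc M n) (z : Site (d + 1)) m) (Sum.inr κ₀) (Sum.inl β)) := fun m' => by
    refine summable_of_ne_finset_zero (s := F₁ ×ˢ Fm) fun p hp => ?_
    rw [Finset.mem_product, not_and_or] at hp
    rcases hp with hp | hp
    · exact hv₁ _ _ _ hp
    · exact hv₃ _ _ _ hp
  symm
  calc (∑' m₁ : Site (d + 1), ∑' m₂ : Site (d + 1), ∑' m : Site (d + 1),
          𝒲 κ (translate (towerTorus Lc M n) (wrapPt (towerTorus Lc M n) u : Site (d + 1)) m₁) κ'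
            (translate (towerTorus Lc M n) (wrapPt (towerTorus Lc M n) u' : Site (d + 1)) m₂) X
            (translate (towerTorus Lc M n) (z : Site (d + 1)) m) (Sum.inr κ₀) (Sum.inl β))
      = ∑' m₁ : Site (d + 1), ∑' m₂ : Site (d + 1), ∑' m : Site (d + 1),
          𝒲 κ (translate (towerTorus Lc M n) u m₁) κ' (translate (towerTorus Lc M n) (wrapPt (towerTorus Lc M n) u' : Site (d + 1)) m₂) X
            (translate (towerTorus Lc M n) (z : Site (d + 1)) m) (Sum.inr κ₀) (Sum.inl β) :=
        hre (fun v => ∑' m₂ : Site (d + 1), ∑' m : Site (d + 1), 𝒲 κ v κ' (translate (towerTorus Lc M n) (wrapPt (towerTorus Lc M n) u' : Site (d + 1)) m₂) X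
          (translate (towerTorus Lc M n) (z : Site (d + 1)) m) (Sum.inr κ₀) (Sum.inl β)) u
    _ = ∑' m₁ : Site (d + 1), ∑' m₂ : Site (d + 1), ∑' m : Site (d + 1),
          𝒲 κ (translate (towerTorus Lc M n) u m₁) κ' (translate (towerTorus Lc M n) u' m₂) X
            (translate (towerTorus Lc M n) (z : Site (d + 1)) m) (Sum.inr κ₀) (Sum.inl β) :=
        tsum_congr fun m₁ => hre (fun v' => ∑' m : Site (d + 1), 𝒲 κ (translate (towerTorus Lc M n) u m₁) κ' v' X
          (translate (towerTorus Lc M n) (z : Site (d + 1)) m) (Sum.inr κ₀) (Sum.inl β)) u'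
    _ = ∑' m₁ : Site (d + 1), ∑' m' : Site (d + 1), ∑' m : Site (d + 1),
          𝒲 κ (translate (towerTorus Lc M n) u m₁) κ' (translate (towerTorus Lc M n) u' (m' + m₁)) X
            (translate (towerTorus Lc M n) (z : Site (d + 1)) m) (Sum.inr κ₀) (Sum.inl β) := by
        refine tsum_congr fun m₁ => ?_
        rw [← (Equiv.addRight m₁).tsum_eq]
        exact tsum_congr fun m' => by rw [Equiv.coe_addRight]
    _ = ∑' m' : Site (d + 1), ∑' m₁ : Site (d + 1), ∑' m : Site (d + 1),
          𝒲 κ (translate (towerTorus Lc M n) u m₁) κ' (translate (towerTorus Lc M n) u' (m' + m₁)) X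
            (translate (towerTorus Lc M n) (z : Site (d + 1)) m) (Sum.inr κ₀) (Sum.inl β) := hsumm₁.tsum_comm
    _ = ∑' m' : Site (d + 1), ∑' m : Site (d + 1), ∑' m₁ : Site (d + 1),
          𝒲 κ (translate (towerTorus Lc M n) u m₁) κ' (translate (towerTorus Lc M n) u' (m' + m₁)) X
            (translate (towerTorus Lc M n) (z : Site (d + 1)) m) (Sum.inr κ₀) (Sum.inl β) := tsum_congr fun m' => (hsumm₂ m').tsum_comm.symm
    _ = ∑' m' : Site (d + 1), ∑' m : Site (d + 1), dper (towerTorus Lc M n) (𝒲 κ u κ' (translate (towerTorus Lc M n) u' m')) X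
          (translate (towerTorus Lc M n) (z : Site (d + 1)) m) (Sum.inr κ₀) (Sum.inl β) := by
        refine tsum_congr fun m' => tsum_congr fun m => ?_
        rw [dper_apply_of_blockCov₂ hM hWt κ u κ' _ X _ (Sum.inr κ₀) (Sum.inl β)]
        simp only [translate_translate]
    _ = ∑' m' : Site (d + 1), perZ (towerTorus Lc M n) (dper (towerTorus Lc M n) (𝒲 κ u κ' (translate (towerTorus Lc M n) u' m'))) X (z : Site (d + 1))
          (Sum.inr κ₀) (Sum.inl β) := by simp only [perZ_apply]

/-- [folklore] **the socket form under a WINDOW-DIAMETER letter and a BOX-SIZE guard** (an2 W-an2-g49-12 (b)'s displayed `K₀` shape): if the window of the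
multiplier site has `ℓ^∞`-diameter `≤ D` and `D + |u i − u′ i| < T i` in every direction, the separation letter holds (`sep_of_window_lt`) and §3's identity follows —
for a growing box sequence and fixed `(u, u′, D)` the guard holds for every box beyond some `K₀`. -/
theorem perZ_dper_eq_compIns₂₂Sym_apply_single_of_diam
    (κ : Fin (d + 1)) (u : Site (d + 1)) (κ' : Fin (d + 1)) (u' : Site (d + 1))
    (x : ↥(pbox M)) (κ₀ : Fin (d + 1)) (z : ↥(pbox (towerTorus Lc M n))) (β : Fin (d + 1)) (D : ℤ)
    (hD : ∀ v ∈ W ((((Lc ^ n : ℕ) : ℤ)) • (x : Site (d + 1))), ∀ v' ∈ W ((((Lc ^ n : ℕ) : ℤ)) • (x : Site (d + 1))), ∀ i : Fin (d + 1), |v i - v' i| ≤ D)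
    (hK : ∀ i : Fin (d + 1), D + |u i - u' i| < (towerTorus Lc M n i : ℤ)) :
    perZ (towerTorus Lc M n) (dper (towerTorus Lc M n) (𝒲 κ u κ' u')) ((((Lc ^ n : ℕ) : ℤ)) • (x : Site (d + 1))) (z : Site (d + 1)) (Sum.inr κ₀) (Sum.inl β)
      = compIns₂₂Sym Lc M lev rs n (fun b => if b = (wrapPt (towerTorus Lc M n) u, κ) then 1 else 0)
          (fun b => if b = (wrapPt (towerTorus Lc M n) u', κ') then 1 else 0) (x, κ₀) (z, β) :=
  perZ_dper_eq_compIns₂₂Sym_apply_single Lc hc 𝓡 hR0 hRsucc 𝓘₁ h0₁ hsucc₁ 𝓘₂ h0₂ hsucc₂ n M lev rs 𝒲 W hWt hS hT hT' h𝒲 κ u κ' u' x κ₀ z β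
    (sep_of_window_lt (towerTorus Lc M n) _ u u' fun v hv v' hv' i => by
      have h1 := abs_le.1 (hD v hv v' hv' i)
      have h2 := le_abs_self (u i - u' i)
      have h3 := neg_abs_le (u i - u' i)
      have h4 := hK i
      exact abs_lt.2 ⟨by linarith, by linarith⟩)

end OrderTwo

end Summit.QuantumFields.BalabanUV.Beta.FP.TorusCompositeInsertionKernelSingleSym

end
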